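import Summits.ResolutionOfSingularities.KangarooAtlas.MizutaniLemma29
import Mathlib.FieldTheory.IntermediateField.Adjoin.Basic
import Mathlib.FieldTheory.IntermediateField.Adjoin.Algebra
import Mathlib.FieldTheory.IntermediateField.Algebraic
import Mathlib.Algebra.Polynomial.Degree.Domain
import HarnessLib

/-!
# Mizutani's Lemma 2.9 (1) AS PRINTED — the field form, by reduction to the tower form

Cell topic `Summits/ResolutionOfSingularities/KangarooAtlas` (pub-rosobs); namespace
`Summit.ResolutionOfSingularities.KangarooAtlas.Mizutani`.  Part of the Lean transcription of Mizutani 1973 §2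
around the in-house note MIZUTANI-PROOF-g59 (AI-written, AI-audited; *AI review is weaker than expert review*; not a
resolution theorem).

Mizutani, Nagoya Math. J. 52 (1973), Lemma 2.9 (1), p. 92: «Let `k ⊃ K ⊃ k^p` with `[K : k^p] = p²` … and let `D` be
an element of `Diff₂(K/k^p)` with `D ≠ 0` and `D(1) = 0`.  Then `dim_{k^p} ker(D) ≤ 2p`.»  The tower form (a `p`-basis
`t₁, t₂` of `K` INSIDE `ker D`) is `IsRootTower.finrank_ker_le_two_mul` (encloser-1 g6, `MizutaniLemma29.lean`).  This
file performs Mizutani's reduction (p. 93 L1–4: «We put `T = ker(D)`.  Then `T` contains `1`.  If `T` is contained in a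
proper subfield of `K`, then (1) is obvious.  Otherwise we may choose elements `t₁` and `t₂` of `T` with
`k^p(t₁, t₂) = K`») for ABSTRACT fields `L ⊆ K` of characteristic `p` with `[K : L] = p²` and `y^p ∈ L` for all `y`:

* `mk_monomial_mem_span_box`, `isRootTower_of_adjoin_eq_top` — a TOWER CONSTRUCTOR: elements `a_i` with `a_i^q = x_i ∈ L`
  generating `K` as an `L`-algebra, with `[K : L] = q^s`, form a root tower (`IsRootTower L K q x a`);
* `finrank_adjoin_simple_eq_of_pow_mem` — `t ∉ L`, `t^p ∈ L`, `[K : L] = p²` ⇒ `[L(t) : L] = p`;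
  `adjoin_pair_eq_top_of_pow_mem` — then `t₂ ∉ L(t₁)` ⇒ `L(t₁, t₂) = K`; `isRootTower_pair` — the resulting tower;
* **`finrank_ker_le_two_mul_of_finrank_eq_sq`** — LEMMA 2.9 (1) as printed.

References: [Mizutani1973HironakaGroupSchemes] Lemma 2.9 (1), p. 92–94.
-/

open MvPolynomial Literature.AlgebraicGeometry.Resolution
open scoped IntermediateField

namespace Summit.ResolutionOfSingularities.KangarooAtlas.Mizutani

universe u

/-! ### A tower constructor: generators with `a_i^q ∈ L`, `L[a] = K`, `[K : L] = q^s` -/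

section Constructor

variable {L K : Type*} [Field L] [Field K] [Algebra L K] {s q : ℕ} {x : Fin s → L} {a : Fin s → K}

/-- Every class of the presentation `L[Y]/(Y^q − x)` is an `L`-combination of the `q^s` box monomials `[Y^W]`,
`W ∈ [0,q)^s` (reduce exponents with `Y_i^q = x_i`). [folklore] -/
theorem mk_monomial_mem_span_box (hq : 0 < q) (P : MvPolynomial (Fin s) L) :
    Ideal.Quotient.mk (rootIdeal L x q) P ∈
      Submodule.span L (Set.range fun W : Fin s → Fin q =>
        Ideal.Quotient.mk (rootIdeal L x q) (monomial (Box.toF W) 1)) := by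
  classical
  set R := RootTower L x q with hR
  set mk := Ideal.Quotient.mk (rootIdeal L x q) with hmk
  letI : SMul L R := Algebra.toSMul
  induction P using MvPolynomial.induction_on' with
  | monomial N c =>
    set W : Fin s → Fin q := fun i => ⟨N i % q, Nat.mod_lt _ hq⟩ with hW
    have hgen : ∀ i, mk (X i) ^ q = algebraMap L R (x i) := fun i => rootGen_pow L x q i
    have hXN : mk (monomial N (1 : L)) =
        algebraMap L R (∏ i, x i ^ (N i / q)) * mk (monomial (Box.toF W) 1) := by
      rw [monomial_eq, MvPolynomial.C_1, one_mul, monomial_eq, MvPolynomial.C_1, one_mul,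
        Finsupp.prod_fintype _ _ (fun i => by simp),
        Finsupp.prod_fintype _ _ (fun i => by simp), map_prod, map_prod, map_prod, ← Finset.prod_mul_distrib]
      refine Finset.prod_congr rfl fun i _ => ?_
      rw [map_pow, map_pow, map_pow, Box.toF_apply]
      conv_lhs => rw [← Nat.div_add_mod (N i) q]
      rw [pow_add, pow_mul, hgen i]
    have hmono : monomial N c = MvPolynomial.C c * monomial N 1 := by rw [MvPolynomial.C_mul_monomial, mul_one]
    have hC : mk (MvPolynomial.C c) = algebraMap L R c := rfl
    rw [hmono, map_mul, hXN, hC, ← mul_assoc, ← map_mul]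
    have key := (Algebra.smul_def (R := L) (A := R) (c * ∏ i, x i ^ (N i / q)) (mk (monomial (Box.toF W) 1))).symm
    rw [key]
    exact Submodule.smul_mem _ _ (Submodule.subset_span ⟨W, rfl⟩)
  | add P Q hP hQ => rw [map_add]; exact Submodule.add_mem _ hP hQ

/-- **Tower constructor.**  If `a_i^q = x_i ∈ L`, the `a_i` generate `K` as an `L`-algebra and `[K : L] = q^s`, then
`K = L(x^{1/q})` is a root tower: the presentation `L[Y]/(Y^q − x) → K` is onto (it hits the generators) and one-to-one
(its source is spanned by `q^s` monomials, its target has dimension `q^s`).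
[cite: Mizutani1973HironakaGroupSchemes, Lemma 2.9 (proof, p. 93: «we may choose t₁, t₂ of T with k^p(t₁,t₂) = K»)] -/
theorem isRootTower_of_adjoin_eq_top [FiniteDimensional L K] (hq : 0 < q)
    (hpow : ∀ i, a i ^ q = algebraMap L K (x i)) (hadj : Algebra.adjoin L (Set.range a) = ⊤)
    (hdim : Module.finrank L K = q ^ s) : IsRootTower L K q x a := by
  classical
  letI : SMul L (RootTower L x q) := Algebra.toSMul
  set φ := liftHom (L := L) (x := x) (q := q) a hpow with hφ
  -- onto: the range is a subalgebra containing the generators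
  have hsurj : Function.Surjective φ := by
    intro z
    have hz : z ∈ (⊤ : Subalgebra L K) := Algebra.mem_top
    rw [← hadj] at hz
    have hle : Algebra.adjoin L (Set.range a) ≤ φ.range :=
      Algebra.adjoin_le (by rintro _ ⟨i, rfl⟩; exact ⟨rootGen L x q i, liftHom_rootGen a hpow i⟩)
    obtain ⟨w, hw⟩ := hle hz
    exact ⟨w, hw⟩
  -- the source is spanned by the `q^s` box monomials
  set v : (Fin s → Fin q) → RootTower L x q := fun W => Ideal.Quotient.mk (rootIdeal L x q) (monomial (Box.toF W) 1)
    with hv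
  have hspan : Submodule.span L (Set.range v) = ⊤ := by
    refine eq_top_iff.mpr fun z _ => ?_
    obtain ⟨P, rfl⟩ := Ideal.Quotient.mk_surjective z
    exact mk_monomial_mem_span_box hq P
  haveI : FiniteDimensional L (RootTower L x q) := by
    refine ⟨⟨Finset.univ.image v, ?_⟩⟩
    rw [Finset.coe_image, Finset.coe_univ, Set.image_univ, hspan]
  have hle : Module.finrank L (RootTower L x q) ≤ q ^ s := by
    have h1 := finrank_range_le_card (R := L) v
    rw [Set.finrank, hspan, finrank_top, Fintype.card_fun, Fintype.card_fin, Fintype.card_fin] at h1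
    exact h1
  -- one-to-one by rank–nullity
  have hinj : Function.Injective φ := by
    have hrn := LinearMap.finrank_range_add_finrank_ker φ.toLinearMap
    have hrange : LinearMap.range φ.toLinearMap = ⊤ := LinearMap.range_eq_top.mpr hsurj
    rw [hrange, finrank_top, hdim] at hrn
    have hker : Module.finrank L (LinearMap.ker φ.toLinearMap) = 0 := by omega
    have hbot : LinearMap.ker φ.toLinearMap = ⊥ := Submodule.finrank_eq_zero.mp hker
    exact LinearMap.ker_eq_bot.mp hbot
  exact ⟨hpow, hinj, hsurj⟩

end Constructor

/-! ### Degrees: `[L(t) : L] = p` and `L(t₁, t₂) = K` -/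

section Degrees

variable {L K : Type*} [Field L] [Field K] [Algebra L K] {p : ℕ} [hp : Fact p.Prime]

/-- **`t ∉ L`, `t^p ∈ L`, `[K : L] = p²` ⇒ `[L(t) : L] = p`**: the minimal polynomial divides `Y^p − t^p`, so the degree
is `≤ p`; it divides `p²` and is not `1`. [cite: Mizutani1973HironakaGroupSchemes, Lemma 2.9 (proof, p. 93: «If T is contained in a proper subfield of K»)] -/
theorem finrank_adjoin_simple_eq_of_pow_mem [FiniteDimensional L K] (hdim : Module.finrank L K = p ^ 2) {t : K}
    (ht : t ∉ (⊥ : IntermediateField L K)) (hpow : t ^ p ∈ Set.range (algebraMap L K)) :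
    Module.finrank L L⟮t⟯ = p := by
  obtain ⟨l, hl⟩ := hpow
  have hint : IsIntegral L t := IsIntegral.of_finite L t
  -- degree ≤ p
  have hle : Module.finrank L L⟮t⟯ ≤ p := by
    rw [IntermediateField.adjoin.finrank hint]
    have hdvd : minpoly L t ∣ Polynomial.X ^ p - Polynomial.C l := by
      apply minpoly.dvd
      rw [map_sub, Polynomial.aeval_X_pow, Polynomial.aeval_C, hl, sub_self]
    have hne : (Polynomial.X ^ p - Polynomial.C l : Polynomial L) ≠ 0 :=
      Polynomial.X_pow_sub_C_ne_zero hp.out.pos l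
    have := Polynomial.natDegree_le_of_dvd hdvd hne
    rwa [Polynomial.natDegree_X_pow_sub_C] at this
  -- degree divides p² and is not 1
  have hdvd : Module.finrank L L⟮t⟯ ∣ p ^ 2 := by
    rw [← hdim, ← Module.finrank_mul_finrank L L⟮t⟯ K]
    exact Dvd.intro _ rfl
  have hne1 : Module.finrank L L⟮t⟯ ≠ 1 := by
    intro h1
    exact ht (IntermediateField.finrank_adjoin_simple_eq_one_iff.mp h1)
  obtain ⟨k, hk, hkeq⟩ := (Nat.dvd_prime_pow hp.out).mp hdvd
  interval_cases k
  · rw [pow_zero] at hkeq; exact absurd hkeq hne1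
  · rw [pow_one] at hkeq; exact hkeq
  · exfalso
    rw [hkeq] at hle
    have h2 : p ^ 2 ≤ p ^ 1 := by rw [pow_one]; exact hle
    have := Nat.pow_le_pow_iff_right hp.out.one_lt |>.mp h2
    omega

/-- **`t₁ ∉ L`, `t₂ ∉ L(t₁)`, `t_i^p ∈ L`, `[K : L] = p²` ⇒ `L(t₁, t₂) = K`** (`[L(t₁,t₂) : L] > p` divides `p²`).
[cite: Mizutani1973HironakaGroupSchemes, Lemma 2.9 (proof, p. 93: «we may choose t₁ and t₂ of T with k^p(t₁,t₂) = K»)] -/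
theorem adjoin_pair_eq_top_of_pow_mem [FiniteDimensional L K] (hdim : Module.finrank L K = p ^ 2) {t₁ t₂ : K}
    (ht₁ : t₁ ∉ (⊥ : IntermediateField L K)) (hpow₁ : t₁ ^ p ∈ Set.range (algebraMap L K))
    (ht₂ : t₂ ∉ L⟮t₁⟯) : IntermediateField.adjoin L {t₁, t₂} = ⊤ := by
  have hp1 := finrank_adjoin_simple_eq_of_pow_mem hdim ht₁ hpow₁
  set F₂ := IntermediateField.adjoin L ({t₁, t₂} : Set K) with hF₂
  have hle : L⟮t₁⟯ ≤ F₂ := IntermediateField.adjoin.mono L _ _ (Set.singleton_subset_iff.mpr (Set.mem_insert _ _))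
  have ht₂F : t₂ ∈ F₂ := IntermediateField.subset_adjoin L _ (Set.mem_insert_of_mem _ (Set.mem_singleton _))
  -- `[F₂ : L] > p`
  have hgt : p < Module.finrank L F₂ := by
    by_contra hnot
    have hle' : Module.finrank L F₂ ≤ Module.finrank L L⟮t₁⟯ := by rw [hp1]; omega
    have heq := IntermediateField.eq_of_le_of_finrank_le hle hle'
    exact ht₂ (heq ▸ ht₂F)
  -- `[F₂ : L] ∣ p²`, hence `= p²`
  have hdvd : Module.finrank L F₂ ∣ p ^ 2 := by
    rw [← hdim, ← Module.finrank_mul_finrank L F₂ K]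
    exact Dvd.intro _ rfl
  obtain ⟨k, hk, hkeq⟩ := (Nat.dvd_prime_pow hp.out).mp hdvd
  have hk2 : k = 2 := by
    interval_cases k
    · rw [pow_zero] at hkeq; rw [hkeq] at hgt; have := hp.out.one_lt; omega
    · rw [pow_one] at hkeq; omega
    · rfl
  rw [hk2] at hkeq
  refine IntermediateField.eq_of_le_of_finrank_eq le_top ?_
  rw [hkeq, IntermediateField.finrank_top', hdim]

/-- The resulting ROOT TOWER on `(t₁, t₂)`: with `x_i` the elements of `L` below `t_i^p`, `IsRootTower L K p x ![t₁, t₂]`.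
[cite: Mizutani1973HironakaGroupSchemes, Lemma 2.9 (proof, p. 93)] -/
theorem isRootTower_pair [FiniteDimensional L K] (hdim : Module.finrank L K = p ^ 2) {t : Fin 2 → K} {x : Fin 2 → L}
    (hx : ∀ i, t i ^ p = algebraMap L K (x i)) (ht₀ : t 0 ∉ (⊥ : IntermediateField L K)) (ht₁ : t 1 ∉ L⟮t 0⟯) :
    IsRootTower L K (p ^ 1) x t := by
  have hpow : ∀ i, t i ^ p ^ 1 = algebraMap L K (x i) := fun i => by rw [pow_one]; exact hx i
  have htop := adjoin_pair_eq_top_of_pow_mem hdim ht₀ ⟨x 0, (hx 0).symm⟩ ht₁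
  haveI : Algebra.IsAlgebraic L K := Algebra.IsAlgebraic.of_finite L K
  have hrange : Set.range t = {t 0, t 1} := by
    ext y
    simp only [Set.mem_range, Set.mem_insert_iff, Set.mem_singleton_iff]
    constructor
    · rintro ⟨i, rfl⟩; fin_cases i <;> simp
    · rintro (rfl | rfl); exacts [⟨0, rfl⟩, ⟨1, rfl⟩]
  have hadj : Algebra.adjoin L (Set.range t) = ⊤ := by
    rw [hrange, ← IntermediateField.adjoin_toSubalgebra, htop]
    rfl
  refine isRootTower_of_adjoin_eq_top (by rw [pow_one]; exact hp.out.pos) hpow hadj ?_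
  rw [hdim, pow_one]

end Degrees

/-! ### Lemma 2.9 (1) as printed -/

section FieldForm

variable {L K : Type u} [Field L] [Field K] [Algebra L K] {p : ℕ} [hp : Fact p.Prime] [CharP K p]

/-- **MIZUTANI'S LEMMA 2.9 (1), as printed.**  `L ⊆ K` fields of characteristic `p` with `[K : L] = p²` and
`y^p ∈ L` for every `y ∈ K` (Mizutani: `k ⊃ K ⊃ k^p`), `D : K → K` an `L`-linear differential operator of order `≤ 2`
with `D ≠ 0` and `D 1 = 0`.  Then `dim_L ker D ≤ 2p`.  Proof as printed: `T = ker D ∋ 1`; if `L(T) ≠ K` then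
`[L(T) : L] ≤ p`; otherwise pick `t₁ ∈ T ∖ L`, `t₂ ∈ T ∖ L(t₁)`, so `K = L(t₁, t₂)` is a root tower with its `p`-basis
in `T`, and the tower form `IsRootTower.finrank_ker_le_two_mul` applies.
[cite: Mizutani1973HironakaGroupSchemes, Lemma 2.9 (1), p. 92, with its proof p. 93–94] -/
theorem finrank_ker_le_two_mul_of_finrank_eq_sq [FiniteDimensional L K] (hdim : Module.finrank L K = p ^ 2)
    (hpow : ∀ y : K, y ^ p ∈ Set.range (algebraMap L K)) (D : K →ₗ[L] K) (hD : IsDiffOpLE L 2 D) (hD0 : D ≠ 0)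
    (h1 : D 1 = 0) : Module.finrank L (LinearMap.ker D) ≤ 2 * p := by
  classical
  set T := LinearMap.ker D with hT
  set E := IntermediateField.adjoin L (T : Set K) with hE
  have hTE : T ≤ E.toSubalgebra.toSubmodule := fun y hy => IntermediateField.subset_adjoin L _ hy
  by_cases htop : E = ⊤
  · -- `T` generates `K`: choose the `p`-basis inside `T`
    have hT1 : ¬ (T : Set K) ⊆ ((⊥ : IntermediateField L K) : Set K) := by
      intro hsub
      have hle : E ≤ ⊥ := IntermediateField.adjoin_le_iff.mpr hsub
      have hbot : (⊥ : IntermediateField L K) = ⊤ := le_antisymm le_top (htop ▸ hle)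
      have h1' := IntermediateField.finrank_eq_one_iff.mpr hbot.symm
      rw [IntermediateField.finrank_top', hdim] at h1'
      have := hp.out.one_lt
      nlinarith
    obtain ⟨t₁, ht₁T, ht₁⟩ := Set.not_subset.mp hT1
    have ht₁' : t₁ ∉ (⊥ : IntermediateField L K) := ht₁
    have hT2 : ¬ (T : Set K) ⊆ (L⟮t₁⟯ : Set K) := by
      intro hsub
      have hle : E ≤ L⟮t₁⟯ := IntermediateField.adjoin_le_iff.mpr hsub
      rw [htop, top_le_iff] at hle
      have hpdeg := finrank_adjoin_simple_eq_of_pow_mem hdim ht₁' (hpow t₁)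
      rw [hle, IntermediateField.finrank_top', hdim] at hpdeg
      have h1 := hp.out.one_lt
      have : p ^ 2 = p * p := sq p
      nlinarith
    obtain ⟨t₂, ht₂T, ht₂⟩ := Set.not_subset.mp hT2
    have ht₂' : t₂ ∉ L⟮t₁⟯ := ht₂
    -- the tower on `(t₁, t₂)`
    set t : Fin 2 → K := ![t₁, t₂] with ht
    choose xf hxf using hpow
    set x : Fin 2 → L := fun i => xf (t i) with hx
    have hxt : ∀ i, t i ^ p = algebraMap L K (x i) := fun i => (hxf (t i)).symm
    have htower : IsRootTower L K (p ^ 1) x t :=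
      isRootTower_pair hdim hxt (by simpa [ht] using ht₁') (by simpa [ht] using ht₂')
    refine htower.finrank_ker_le_two_mul D hD hD0 h1 fun i => ?_
    fin_cases i
    · simpa [ht] using LinearMap.mem_ker.mp ht₁T
    · simpa [ht] using LinearMap.mem_ker.mp ht₂T
  · -- `T` lies in the proper subfield `E`, of degree `≤ p`
    have hdvd : Module.finrank L E ∣ p ^ 2 := by
      rw [← hdim, ← Module.finrank_mul_finrank L E K]
      exact Dvd.intro _ rfl
    obtain ⟨k, hk, hkeq⟩ := (Nat.dvd_prime_pow hp.out).mp hdvd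
    have hEle : Module.finrank L E ≤ p := by
      interval_cases k
      · rw [hkeq, pow_zero]; exact hp.out.one_lt.le
      · rw [hkeq, pow_one]
      · exfalso
        apply htop
        refine IntermediateField.eq_of_le_of_finrank_eq le_top ?_
        rw [hkeq, IntermediateField.finrank_top', hdim]
    calc Module.finrank L T ≤ Module.finrank L E.toSubalgebra.toSubmodule := Submodule.finrank_mono hTE
      _ = Module.finrank L E := rfl
      _ ≤ p := hEle
      _ ≤ 2 * p := by omega

end FieldForm

end Summit.ResolutionOfSingularities.KangarooAtlas.Mizutani
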